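import Literature.Geometry.Riemannian.ColdingCommonGoodGeodesics
import Literature.Geometry.Riemannian.CosDistSecondMoment
import Literature.Geometry.Riemannian.ColdingSyntheticFrameExtension
import HarnessLib

/-!
# Almost orthogonal frames in almost maximal volume manifolds (Colding 1996a, §2)

A step of the Gromov–Hausdorff assembly in Colding's volume sphere theorem
(`Colding1996_volume_ghClose`): on a closed `n`-manifold with `Ric ≥ n − 1` and almost maximal
volume one finds `n + 1` points `x_0, …, x_n` with `|cos d(x_i, x_j)| ≤ α` for `i ≠ j` — the
analogue of an orthonormal basis `e_0, …, e_n` of `ℝⁿ⁺¹ ⊃ Sⁿ`. The construction is by extension: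
given `x_0, …, x_j` (`j + 1 ≤ n`), a minimiser `z*` of `F = Σ_i cos² d_{x_i}` has `F(z*)` small.
Indeed `min F ≤ mean F ≤ (j+1)/(n+1) + ψ < 1` (second moments, `CosDistSecondMoment.lean`), and
if `F(z*)` were not small, moving from the (almost) antipode of the `x_i` with the largest
`|cos d_{x_i}(z*)|` towards `z*` along a common good geodesic (Lemma 2.10,
`ColdingCommonGoodGeodesics.lean`) to the point where `cos d_{x_i}` vanishes would produce a
point with smaller `F` ("project away the largest component and renormalise":
`F' ≤ (F − a)/(1 − a) < F` for `F < 1`).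

* §1 `good_paths_of_good_geodesics` — the conclusion of Lemma 2.10 read in the length metric
  space `(M, d_g)` (`g.metricSpace hg`): continuous good paths `s ↦ exp_{z₁}(s v)`, the input
  format of the synthetic core `ColdingSynthetic.exists_sum_cos_dist_sq_le`
  (`ColdingSyntheticFrameExtension.lean`).
* §2 `exists_deficit_forall_good_geodesics_and_antipodes` — one volume deficit providing both
  the common good geodesics (`β = r = ε`) for all families of a given size and uniform almost
  antipodes for all points; `exists_almost_orthogonal_frame` — the frames, by induction on the
  size (the mean of `F` is `≤ (j+1)/((n+1)(1−δ)) ≤ 1 − 1/(2(n+1))` by the second moments and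
  `MeasureTheory.exists_le_average`).

Everything here is proved; no definitions, no named facts (D-0026).

## References

* T. H. Colding, *Shape of manifolds with positive Ricci curvature*, Invent. Math. 124 (1996)
  175–191, §2. [Colding1996Shape]
* T. H. Colding, *Aspects of Ricci curvature* (1997), Thm. 2.2. [Colding1997Aspects]
-/

noncomputable section

open Bundle Set Function Filter MeasureTheory Manifold
open scoped Manifold ContDiff Topology ENNReal BigOperators

namespace Literature.Geometry.Riemannian

open Lorentzian Lorentzian.PseudoRiemannianMetric

/-! ### §1 Good geodesics as good paths of the length metric space -/

section Paths

variable {m : ℕ} {M : Type*} [TopologicalSpace M] [T2Space M] [SecondCountableTopology M]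
  [ChartedSpace (EuclideanSpace ℝ (Fin m)) M] [IsManifold (𝓡 m) ∞ M]
  (g : PseudoRiemannianMetric (𝓡 m) ∞ (EuclideanSpace ℝ (Fin m)) (TangentSpace (𝓡 m) : M → Type _))
  [ConnectedSpace M] [CompactSpace M] [g.HasLeviCivita]

omit [SecondCountableTopology M] [CompactSpace M] in
/-- **Good geodesics are good paths.** The conclusion of Lemma 2.10 for a family `x` (minimal
geodesics `s ↦ exp_{z₁}(s v)` between `r`-perturbed endpoints along which every `cos d_{x_i}` obeys
the `β`-interpolation law), read in the length metric space `(M, d_g)`: continuous paths with the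
same endpoints and the same law. [cite: Colding1996Shape, §2, Lemma 2.10] -/
theorem good_paths_of_good_geodesics (hg : g.IsRiemannian) (hc : IsGeodesicallyComplete g.leviCivita)
    {ι : Type*} (x : ι → M) {r β : ℝ}
    (hgood : ∀ y₁ y₂ : M, ∃ (z₁ z₂ : M) (v : TangentSpace (𝓡 m) z₁),
      (g.edist hg y₁ z₁).toReal ≤ r ∧ (g.edist hg y₂ z₂).toReal ≤ r ∧
      IsMinimizingUpTo g hg z₁ v 1 ∧ expMap g.leviCivita z₁ v = z₂ ∧
      ∀ i, ∀ s ∈ Icc (0:ℝ) 1,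
        |Real.sin (g.edist hg z₁ z₂).toReal *
            Real.cos (g.edist hg (x i) (expMap g.leviCivita z₁ (s • v))).toReal -
          (Real.sin ((1 - s) * (g.edist hg z₁ z₂).toReal) * Real.cos (g.edist hg (x i) z₁).toReal +
            Real.sin (s * (g.edist hg z₁ z₂).toReal) * Real.cos (g.edist hg (x i) z₂).toReal)| ≤ β) :
    letI := g.metricSpace hg
    ∀ y₁ y₂ : M, ∃ (z₁ z₂ : M) (p : ℝ → M), dist y₁ z₁ ≤ r ∧ dist y₂ z₂ ≤ r ∧
      Continuous p ∧ p 0 = z₁ ∧ p 1 = z₂ ∧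
      ∀ i, ∀ s ∈ Icc (0:ℝ) 1,
        |Real.sin (dist z₁ z₂) * Real.cos (dist (x i) (p s)) -
          (Real.sin ((1 - s) * dist z₁ z₂) * Real.cos (dist (x i) z₁) +
            Real.sin (s * dist z₁ z₂) * Real.cos (dist (x i) z₂))| ≤ β := by
  letI := g.metricSpace hg
  have hk1 : ((1 : ℕ∞) : ℕ∞ω) + 1 ≤ ((⊤ : ℕ∞) : ℕ∞ω) := by
    rw [show ((1 : ℕ∞) : ℕ∞ω) + 1 = 2 by norm_num]
    exact WithTop.coe_le_coe.2 le_top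
  haveI : CovariantDerivative.ContMDiffCovariantDerivative g.leviCivita 1 :=
    ⟨g.isLocallyContMDiff_leviCivita_holds 1 hk1 univ isOpen_univ⟩
  intro y₁ y₂
  obtain ⟨z₁, z₂, v, h1, h2, h3, h4, h5⟩ := hgood y₁ y₂
  have hpath : Continuous fun s : ℝ ↦ expMap g.leviCivita z₁ (s • v) := by
    have e : (fun s : ℝ ↦ expMap g.leviCivita z₁ (s • v)) =
        fun s ↦ maximalGeodesic g.leviCivita z₁ v s := funext fun s ↦ expMap_smul hc z₁ v s
    rw [e]
    exact (maximalGeodesic_of_isGeodesicallyComplete hc z₁ v).2.1.continuous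
  refine ⟨z₁, z₂, fun s ↦ expMap g.leviCivita z₁ (s • v), h1, h2, hpath, ?_, ?_, fun i s hs ↦ h5 i s hs⟩
  · show expMap g.leviCivita z₁ ((0:ℝ) • v) = z₁
    rw [zero_smul, expMap_zero]
  · show expMap g.leviCivita z₁ ((1:ℝ) • v) = z₂
    rw [one_smul, h4]

end Paths

/-! ### §2 The smallness provider and the frames, in the binders of the fact -/

section FactVocabulary

open Literature.Geometry.Lorentzian (riemannianMeasure)

/-- **One volume deficit for common good geodesics AND uniform almost antipodes.** For `n ≥ 2`,
`m` and `ε > 0` there is `0 < δ ≤ ε` such that under `Ric ≥ (n−1)h`, `μ_h(M) ≥ (1 − δ)|Sⁿ|`: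
(a) every family `x : Fin m → M` has common good geodesics near every pair with `β = r = ε`
(Lemma 2.10, `exists_volume_deficit_forall_exists_near_common_good_geodesic`), and (b) every
point `p` has an almost antipode `p̄` with `sup_w |cos d(p, w) + cos d(p̄, w)| ≤ ε`
(`exists_riemannianEDist_ge_pi_sub_of_volume_ge` with `abs_cos_edist_add_cos_edist_le`).
[cite: Colding1996Shape, §2, Lemma 2.10] [cite: Colding1997Aspects, Thm. 2.2 (proof)] -/
theorem exists_deficit_forall_good_geodesics_and_antipodes (n : ℕ) (hn : 2 ≤ n) (m : ℕ)
    {ε : ℝ} (hε : 0 < ε) :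
    ∃ δ : ℝ, 0 < δ ∧ δ ≤ ε ∧ ∀ (M : Type) [TopologicalSpace M] [T2Space M]
      [SecondCountableTopology M] [ChartedSpace (EuclideanSpace ℝ (Fin n)) M]
      [IsManifold (𝓡 n) ∞ M] [CompactSpace M] [ConnectedSpace M] [MeasurableSpace M] [BorelSpace M]
      (h : Bundle.ContMDiffRiemannianMetric (𝓡 n) ∞ (EuclideanSpace ℝ (Fin n))
        (TangentSpace (𝓡 n) : M → Type _))
      [(PseudoRiemannianMetric.ofRiemannian h).HasLeviCivita],
      (∀ (x : M) (v : TangentSpace (𝓡 n) x),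
          ((n : ℝ) - 1) * h.inner x v v ≤ (PseudoRiemannianMetric.ofRiemannian h).ricci x v v) →
        ENNReal.ofReal ((1 - δ) * unitSphereVolume n) ≤ riemannianMeasure h univ →
          (∀ (x : Fin m → M) (y₁ y₂ : M), ∃ (z₁ z₂ : M) (v : TangentSpace (𝓡 n) z₁),
            ((PseudoRiemannianMetric.ofRiemannian h).edist
                (PseudoRiemannianMetric.isRiemannian_ofRiemannian h) y₁ z₁).toReal ≤ ε ∧
            ((PseudoRiemannianMetric.ofRiemannian h).edist
                (PseudoRiemannianMetric.isRiemannian_ofRiemannian h) y₂ z₂).toReal ≤ ε ∧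
            IsMinimizingUpTo (PseudoRiemannianMetric.ofRiemannian h)
                (PseudoRiemannianMetric.isRiemannian_ofRiemannian h) z₁ v 1 ∧
            expMap (PseudoRiemannianMetric.ofRiemannian h).leviCivita z₁ v = z₂ ∧
            ∀ i, ∀ s ∈ Icc (0:ℝ) 1,
              |Real.sin ((PseudoRiemannianMetric.ofRiemannian h).edist
                    (PseudoRiemannianMetric.isRiemannian_ofRiemannian h) z₁ z₂).toReal *
                  Real.cos ((PseudoRiemannianMetric.ofRiemannian h).edist
                    (PseudoRiemannianMetric.isRiemannian_ofRiemannian h) (x i)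
                    (expMap (PseudoRiemannianMetric.ofRiemannian h).leviCivita z₁ (s • v))).toReal -
                (Real.sin ((1 - s) * ((PseudoRiemannianMetric.ofRiemannian h).edist
                    (PseudoRiemannianMetric.isRiemannian_ofRiemannian h) z₁ z₂).toReal) *
                    Real.cos ((PseudoRiemannianMetric.ofRiemannian h).edist
                      (PseudoRiemannianMetric.isRiemannian_ofRiemannian h) (x i) z₁).toReal +
                  Real.sin (s * ((PseudoRiemannianMetric.ofRiemannian h).edist
                    (PseudoRiemannianMetric.isRiemannian_ofRiemannian h) z₁ z₂).toReal) *
                    Real.cos ((PseudoRiemannianMetric.ofRiemannian h).edist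
                      (PseudoRiemannianMetric.isRiemannian_ofRiemannian h) (x i) z₂).toReal)| ≤ ε) ∧
          (∀ p : M, ∃ pb : M, ∀ w : M,
            |Real.cos ((PseudoRiemannianMetric.ofRiemannian h).edist
                (PseudoRiemannianMetric.isRiemannian_ofRiemannian h) p w).toReal +
              Real.cos ((PseudoRiemannianMetric.ofRiemannian h).edist
                (PseudoRiemannianMetric.isRiemannian_ofRiemannian h) pb w).toReal| ≤ ε) := by
  have hn0 : (n : ℝ) ≠ 0 := by exact_mod_cast (show n ≠ 0 by omega)
  have hinv0 : (0 : ℝ) ≤ (n : ℝ)⁻¹ := by positivity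
  have hinv_ne : ((n : ℝ)⁻¹) ≠ 0 := inv_ne_zero hn0
  -- (a) Lemma 2.10 with `β = ε`, `r = min ε 1`
  have hr0 : 0 < min ε 1 := by positivity
  have hrπ : min ε 1 ≤ Real.pi := (min_le_right _ _).trans (by linarith [Real.pi_gt_three])
  obtain ⟨δa, hδa, hgood⟩ :=
    exists_volume_deficit_forall_exists_near_common_good_geodesic n hn m hε hr0 hrπ
  -- (b) the antipodal defect `η(δ) → 0`
  set d1 : ℝ → ℝ := fun δ ↦ (2 * Real.pi ^ n * δ) ^ ((n : ℝ)⁻¹) with hd1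
  set eta : ℝ → ℝ := fun δ ↦ d1 δ + (2 * n * Real.pi ^ (n - 1) * d1 δ) ^ ((n : ℝ)⁻¹) with heta
  have hc_d1 : Continuous d1 :=
    (Real.continuous_rpow_const hinv0).comp (continuous_const.mul continuous_id)
  have hc_eta : Continuous eta :=
    hc_d1.add ((Real.continuous_rpow_const hinv0).comp (continuous_const.mul hc_d1))
  have hd1_0 : d1 0 = 0 := by simp only [hd1, mul_zero, Real.zero_rpow hinv_ne]
  have heta_0 : eta 0 = 0 := by
    simp only [heta, hd1_0, mul_zero, Real.zero_rpow hinv_ne, add_zero]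
  have hev : ∀ᶠ δ in 𝓝 (0 : ℝ), eta δ < ε ∧ d1 δ < Real.pi / (2 * n) := by
    refine ((hc_eta.tendsto 0).eventually (gt_mem_nhds ?_)).and
      ((hc_d1.tendsto 0).eventually (gt_mem_nhds ?_))
    · rwa [heta_0]
    · rw [hd1_0]; positivity
  obtain ⟨δ₀, hδ₀, hball⟩ := Metric.eventually_nhds_iff.1 hev
  set δ : ℝ := min δa (min (δ₀ / 2) (min ε (1 / 4))) with hδ_def
  have hδpos : 0 < δ := by positivity
  have hδa' : δ ≤ δa := min_le_left _ _
  have hδε : δ ≤ ε := ((min_le_right _ _).trans (min_le_right _ _)).trans (min_le_left _ _)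
  have hδlt : δ < 1 / 2 :=
    (((min_le_right _ _).trans (min_le_right _ _)).trans (min_le_right _ _)).trans_lt (by norm_num)
  have hδball : dist δ 0 < δ₀ := by
    rw [Real.dist_eq, sub_zero, abs_of_pos hδpos]
    exact ((min_le_right _ _).trans (min_le_left _ _)).trans_lt (by linarith)
  obtain ⟨hetaε, hd1lt⟩ := hball hδball
  refine ⟨δ, hδpos, hδε, ?_⟩
  intro M _ _ _ _ _ _ _ _ _ h _ hRic hvol
  set g := PseudoRiemannianMetric.ofRiemannian h with hg_def
  set hg : g.IsRiemannian := PseudoRiemannianMetric.isRiemannian_ofRiemannian h with hg'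
  have hσ0 : 0 < unitSphereVolume n := unitSphereVolume_pos n
  have hmono : ∀ {δ' : ℝ}, δ ≤ δ' →
      ENNReal.ofReal ((1 - δ') * unitSphereVolume n) ≤ riemannianMeasure h univ := fun hle ↦
    (ENNReal.ofReal_le_ofReal (mul_le_mul_of_nonneg_right (by linarith) hσ0.le)).trans hvol
  refine ⟨fun x y₁ y₂ ↦ ?_, fun p ↦ ?_⟩
  · obtain ⟨z₁, z₂, v, h1, h2, h3, h4, h5⟩ := hgood M h hRic (hmono hδa') x y₁ y₂
    exact ⟨z₁, z₂, v, h1.trans (min_le_left _ _), h2.trans (min_le_left _ _), h3, h4, h5⟩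
  · obtain ⟨q, hpq⟩ := exists_riemannianEDist_ge_pi_sub_of_volume_ge n hn M h hRic hδlt hvol p
    have hd1pos : 0 ≤ d1 δ := Real.rpow_nonneg (by positivity) _
    refine ⟨q, fun w ↦ ?_⟩
    have key := abs_cos_edist_add_cos_edist_le g hg hn (fun x v ↦ hRic x v) hd1pos hd1lt hpq w
    exact key.trans hetaε.le

/-- **A point where `Σ_i cos² d_{x_i}` is at most its mean** `≤ card · |Sⁿ|/((n+1) μ(M))`
(second moments `integral_cos_sq_riemannianEDist_le` and `MeasureTheory.exists_le_average`).
[cite: Colding1996Shape, §2] -/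
theorem exists_sum_cos_sq_edist_le_card_mul_div (n : ℕ) (hn : 2 ≤ n)
    (M : Type) [TopologicalSpace M] [T2Space M] [SecondCountableTopology M]
    [ChartedSpace (EuclideanSpace ℝ (Fin n)) M] [IsManifold (𝓡 n) ∞ M] [CompactSpace M]
    [ConnectedSpace M] [MeasurableSpace M] [BorelSpace M]
    (h : Bundle.ContMDiffRiemannianMetric (𝓡 n) ∞ (EuclideanSpace ℝ (Fin n))
      (TangentSpace (𝓡 n) : M → Type _))
    [(PseudoRiemannianMetric.ofRiemannian h).HasLeviCivita]
    (hRic : ∀ (x : M) (v : TangentSpace (𝓡 n) x),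
      ((n : ℝ) - 1) * h.inner x v v ≤ (PseudoRiemannianMetric.ofRiemannian h).ricci x v v)
    (hμ : riemannianMeasure h ≠ 0) {ι : Type*} [Fintype ι] (x : ι → M) :
    ∃ z₀ : M, ∑ i, Real.cos ((PseudoRiemannianMetric.ofRiemannian h).edist
        (PseudoRiemannianMetric.isRiemannian_ofRiemannian h) (x i) z₀).toReal ^ 2 ≤
      Fintype.card ι * (unitSphereVolume n / (n + 1)) / (riemannianMeasure h).real univ := by
  classical
  set g := PseudoRiemannianMetric.ofRiemannian h with hg_def
  set hg : g.IsRiemannian := PseudoRiemannianMetric.isRiemannian_ofRiemannian h with hg'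
  haveI : IsFiniteMeasure (riemannianMeasure h) :=
    ⟨riemannianVolume_lt_top_of_isCompact_holds h le_rfl isCompact_univ⟩
  have hci : ∀ i, Continuous fun w ↦ Real.cos (g.edist hg (x i) w).toReal ^ 2 := fun i ↦
    (Real.continuous_cos.comp (continuous_edist_toReal g hg (x i))).pow 2
  have hFc : Continuous fun w ↦ ∑ i, Real.cos (g.edist hg (x i) w).toReal ^ 2 :=
    continuous_finsetSum _ fun i _ ↦ hci i
  have hFi : Integrable (fun w ↦ ∑ i, Real.cos (g.edist hg (x i) w).toReal ^ 2)
      (riemannianMeasure h) := integrable_of_continuous h hFc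
  obtain ⟨z₀, hz₀⟩ := MeasureTheory.exists_le_average hμ hFi
  refine ⟨z₀, hz₀.trans ?_⟩
  rw [MeasureTheory.average_eq, smul_eq_mul, div_eq_inv_mul]
  refine mul_le_mul_of_nonneg_left ?_ (inv_nonneg.2 measureReal_nonneg)
  have hint_i : ∀ i ∈ (Finset.univ : Finset ι),
      Integrable (fun w ↦ Real.cos (g.edist hg (x i) w).toReal ^ 2) (riemannianMeasure h) :=
    fun i _ ↦ integrable_of_continuous h (hci i)
  rw [integral_finsetSum (μ := riemannianMeasure h) Finset.univ hint_i]
  have h2 := Finset.sum_le_card_nsmul Finset.univ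
    (fun i ↦ ∫ w, Real.cos (g.edist hg (x i) w).toReal ^ 2 ∂riemannianMeasure h)
    (unitSphereVolume n / (n + 1)) fun i _ ↦ integral_cos_sq_riemannianEDist_le n M h hn hRic (x i)
  rwa [Finset.card_univ, nsmul_eq_mul] at h2

/-- **Almost orthogonal frames exist** (Colding 1996a, §2): for `n ≥ 2`, `k + 1 ≤ n + 1` and
`α > 0` there is `δ > 0` such that every closed connected Riemannian `n`-manifold with
`Ric ≥ (n−1)h` and `μ_h(M) ≥ (1 − δ)|Sⁿ|` contains `k + 1` points `x_0, …, x_k` with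
`|cos d(x_i, x_j)| ≤ α` for `i ≠ j`. Induction on `k`: the extension step is
`exists_sum_cos_edist_sq_le_of_good_geodesics`, fed by Lemma 2.10 and the almost antipodes
(`exists_deficit_forall_good_geodesics_and_antipodes`) and by a point with `Σ_i cos² d_{x_i} ≤`
mean `≤ (k+1)/((n+1)(1−δ)) ≤ 1 − 1/(2(n+1))` (`integral_cos_sq_riemannianEDist_le`,
`MeasureTheory.exists_le_average`). [cite: Colding1996Shape, §2] -/
theorem exists_almost_orthogonal_frame (n : ℕ) (hn : 2 ≤ n) (k : ℕ) (hk : k + 1 ≤ n + 1)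
    {α : ℝ} (hα : 0 < α) :
    ∃ δ : ℝ, 0 < δ ∧ ∀ (M : Type) [TopologicalSpace M] [T2Space M]
      [SecondCountableTopology M] [ChartedSpace (EuclideanSpace ℝ (Fin n)) M]
      [IsManifold (𝓡 n) ∞ M] [CompactSpace M] [ConnectedSpace M] [MeasurableSpace M] [BorelSpace M]
      (h : Bundle.ContMDiffRiemannianMetric (𝓡 n) ∞ (EuclideanSpace ℝ (Fin n))
        (TangentSpace (𝓡 n) : M → Type _))
      [(PseudoRiemannianMetric.ofRiemannian h).HasLeviCivita],
      (∀ (x : M) (v : TangentSpace (𝓡 n) x),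
          ((n : ℝ) - 1) * h.inner x v v ≤ (PseudoRiemannianMetric.ofRiemannian h).ricci x v v) →
        ENNReal.ofReal ((1 - δ) * unitSphereVolume n) ≤ riemannianMeasure h univ →
          ∃ x : Fin (k + 1) → M, ∀ i j, i ≠ j →
            |Real.cos ((PseudoRiemannianMetric.ofRiemannian h).edist
              (PseudoRiemannianMetric.isRiemannian_ofRiemannian h) (x i) (x j)).toReal| ≤ α := by
  induction k generalizing α with
  | zero =>
    refine ⟨1 / 2, by norm_num, ?_⟩
    intro M _ _ _ _ _ _ _ _ _ h _ hRic hvol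
    refine ⟨fun _ ↦ Classical.arbitrary M, fun i j hij ↦ ?_⟩
    exact absurd (Fin.ext (by have := i.isLt; have := j.isLt; omega)) hij
  | succ k ih =>
    -- parameters
    have hK : k + 1 ≤ n := by omega
    set Kr : ℝ := (k : ℝ) + 1 with hKr
    have hcard : (Fintype.card (Fin (k + 1)) : ℝ) = Kr := by
      rw [Fintype.card_fin]; push_cast; rfl
    have hK0 : (0 : ℝ) < Kr := by positivity
    have hK1 : (1 : ℝ) ≤ Kr := by rw [hKr]; linarith only [(Nat.cast_nonneg k : (0:ℝ) ≤ k)]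
    have hK2 : (1 : ℝ) ≤ Kr ^ 2 := by nlinarith only [hK1]
    have hKn : Kr ≤ n := by rw [hKr]; exact_mod_cast hK
    set α₁ : ℝ := min α 1 with hα₁
    have hα₁0 : 0 < α₁ := by positivity
    have hα₁1 : α₁ ≤ 1 := min_le_right _ _
    set γ : ℝ := α₁ ^ 2 with hγ
    have hγ0 : 0 < γ := by positivity
    have hγ1 : γ ≤ 1 := by rw [hγ]; nlinarith only [hα₁0, hα₁1]
    set γ₁ : ℝ := 1 / (2 * (n + 1)) with hγ₁
    have hγ₁0 : 0 < γ₁ := by positivity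
    have hγ₁1 : γ₁ ≤ 1 := by
      rw [hγ₁, div_le_one (by positivity)]; linarith only [hKn, hK1]
    have hγγ0 : 0 < γ * γ₁ := mul_pos hγ0 hγ₁0
    have hγγ1 : γ * γ₁ ≤ γ₁ := by nlinarith only [hγ1, hγ₁0.le]
    have hγγ2 : γ * γ₁ ≤ γ := by nlinarith only [hγ₁1, hγ0.le]
    have hγγle1 : γ * γ₁ ≤ 1 := hγγ1.trans hγ₁1
    have hα₁α : α₁ ≤ α := min_le_left _ _
    set ε' : ℝ := min (α₁ / 2) (γ * γ₁ / (40 * Kr ^ 2)) with hε'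
    have hε'0 : 0 < ε' := by positivity
    have hε'α : ε' ≤ α₁ / 2 := min_le_left _ _
    have hε'b : ε' ≤ γ * γ₁ / (40 * Kr ^ 2) := min_le_right _ _
    have h40 : 40 * Kr ^ 2 * ε' ≤ γ * γ₁ := by
      have h1 := hε'b
      rw [le_div_iff₀ (by positivity)] at h1
      linarith only [h1]
    have h40' : 40 * ε' ≤ 40 * Kr ^ 2 * ε' := by nlinarith only [hK2, hε'0.le]
    have hε'le1 : ε' ≤ 1 / 40 := by linarith only [h40, h40', hγγle1]
    -- the deficits
    obtain ⟨δ₁, hδ₁, hframe⟩ := ih (by omega) hε'0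
    obtain ⟨δ₂, hδ₂, -, hprov⟩ := exists_deficit_forall_good_geodesics_and_antipodes n hn (k + 1) hε'0
    set δ : ℝ := min δ₁ (min δ₂ (1 / (2 * (n : ℝ) + 1))) with hδ
    have hδ0 : 0 < δ := by positivity
    refine ⟨δ, hδ0, ?_⟩
    intro M _ _ _ _ _ _ _ _ _ h _ hRic hvol
    set g := PseudoRiemannianMetric.ofRiemannian h with hg_def
    set hg : g.IsRiemannian := PseudoRiemannianMetric.isRiemannian_ofRiemannian h with hg'
    haveI : LocallyCompactSpace M := Manifold.locallyCompact_of_finiteDimensional (𝓡 n)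
    haveI : T3Space M := inferInstance
    have hvolg : g.riemVolume = riemannianMeasure h := PseudoRiemannianMetric.riemVolume_eq hg
    have hUtop : riemannianMeasure h univ ≠ ⊤ := by
      rw [← hvolg]; exact g.riemVolume_univ_lt_top.ne
    haveI : IsFiniteMeasure (riemannianMeasure h) := ⟨lt_top_iff_ne_top.2 hUtop⟩
    have hσ0 : 0 < unitSphereVolume n := unitSphereVolume_pos n
    have hmono : ∀ {δ' : ℝ}, δ ≤ δ' →
        ENNReal.ofReal ((1 - δ') * unitSphereVolume n) ≤ riemannianMeasure h univ := fun hle ↦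
      (ENNReal.ofReal_le_ofReal (mul_le_mul_of_nonneg_right (by linarith) hσ0.le)).trans hvol
    obtain ⟨x, hx⟩ := hframe M h hRic (hmono (min_le_left _ _))
    obtain ⟨hgood, hanti⟩ := hprov M h hRic (hmono ((min_le_right _ _).trans (min_le_left _ _)))
    -- Myers and completeness
    have hfinE : Module.finrank ℝ (EuclideanSpace ℝ (Fin n)) = n := finrank_euclideanSpace_fin
    have hdiam : ∀ y z : M, (g.edist hg y z).toReal ≤ Real.pi := by
      intro y z
      have h' := edist_le_pi_div_sqrt_of_ricci_ge_of_compactSpace g hg (by rw [hfinE]; exact hn)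
        one_pos (fun x w ↦ by rw [hfinE, mul_one]; exact hRic x w) y z
      rw [Real.sqrt_one, div_one] at h'
      exact ENNReal.toReal_le_of_le_ofReal Real.pi_pos.le h'
    have hc : IsGeodesicallyComplete g.leviCivita := hopfRinow_compact_geodesicallyComplete le_rfl hg
    -- a point with `F ≤ 1 − γ₁` (mean value)
    have hδle : δ ≤ 1 / (2 * (n : ℝ) + 1) := (min_le_right _ _).trans (min_le_right _ _)
    have h1δ : 0 < 1 - δ := by
      have h1 : 1 / (2 * (n : ℝ) + 1) < 1 := by
        rw [div_lt_one (by positivity)]; linarith only [hKn, hK1]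
      linarith only [h1, hδle]
    have hμ0 : riemannianMeasure h ≠ 0 := by
      intro h0
      have h1 : riemannianMeasure h univ = 0 := by rw [h0]; rfl
      have h2 : (0 : ℝ≥0∞) < ENNReal.ofReal ((1 - δ) * unitSphereVolume n) :=
        ENNReal.ofReal_pos.2 (mul_pos h1δ hσ0)
      rw [h1] at hvol
      exact absurd hvol (not_le.2 h2)
    set V : ℝ := (riemannianMeasure h).real univ with hV
    have hVge : (1 - δ) * unitSphereVolume n ≤ V := by
      rw [hV, measureReal_def]
      exact (ENNReal.ofReal_le_iff_le_toReal hUtop).1 hvol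
    have hV0 : 0 < V := lt_of_lt_of_le (mul_pos h1δ hσ0) hVge
    have hz₀ : ∃ z₀ : M, ∑ i, Real.cos (g.edist hg (x i) z₀).toReal ^ 2 ≤ 1 - γ₁ := by
      obtain ⟨z₀, hz₀⟩ := exists_sum_cos_sq_edist_le_card_mul_div n hn M h hRic hμ0 x
      refine ⟨z₀, hz₀.trans ?_⟩
      rw [hcard, div_le_iff₀ hV0]
      have h1 : 1 - γ₁ = (2 * n + 1) / (2 * (n + 1)) := by
        rw [hγ₁]; field_simp; ring
      have h2 : (2 * (n : ℝ)) / (2 * n + 1) ≤ 1 - δ := by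
        rw [div_le_iff₀ (by positivity)]
        have h3 := hδle
        rw [le_div_iff₀ (by positivity)] at h3
        linarith only [h3]
      have h4 : 0 ≤ unitSphereVolume n * ((2 * n + 1) / (2 * (n + 1))) := by positivity
      calc Kr * (unitSphereVolume n / (n + 1)) ≤ n * (unitSphereVolume n / (n + 1)) :=
            mul_le_mul_of_nonneg_right hKn (by positivity)
        _ = (2 * n) / (2 * n + 1) * (unitSphereVolume n * ((2 * n + 1) / (2 * (n + 1)))) := by
            field_simp
        _ ≤ (1 - δ) * (unitSphereVolume n * ((2 * n + 1) / (2 * (n + 1)))) :=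
            mul_le_mul_of_nonneg_right h2 h4
        _ = (1 - γ₁) * ((1 - δ) * unitSphereVolume n) := by rw [h1]; ring
        _ ≤ (1 - γ₁) * V := mul_le_mul_of_nonneg_left hVge (by linarith only [hγ₁1])
    -- the smallness conditions (`card = k + 1`, `α = β = r = η = ε'`)
    have hr2 : (Fintype.card (Fin (k + 1)) : ℝ) * ε' ^ 2 < γ := by
      rw [hcard]
      have a0 : 0 ≤ (Kr - 1) * Kr := mul_nonneg (sub_nonneg.2 hK1) hK0.le
      have a1 : Kr * ε' ^ 2 ≤ (Kr ^ 2 * ε') * ε' := by nlinarith only [a0, sq_nonneg ε']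
      have a2 : Kr ^ 2 * ε' ≤ γ * γ₁ / 40 := by linarith only [h40]
      have a3 : (Kr ^ 2 * ε') * ε' ≤ (γ * γ₁ / 40) * (1 / 40) :=
        mul_le_mul a2 hε'le1 hε'0.le (by positivity)
      linarith only [a1, a3, hγγ2, hγ0]
    have hηr : ε' + ε' < 1 := by linarith only [hε'le1]
    have hε₂ : 3 * (ε' + 2 * ε') ≤ γ₁ / 2 := by linarith only [h40, h40', hγγ1, hγ₁0]
    have hεK : 3 * (Fintype.card (Fin (k + 1)) : ℝ) * (ε' + ε' + 2 * ε' + ε') + 3 * (ε' + 2 * ε') <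
        γ * γ₁ / Fintype.card (Fin (k + 1)) := by
      rw [hcard, lt_div_iff₀ hK0]
      have c0 : 0 ≤ (Kr - 1) * Kr * ε' :=
        mul_nonneg (mul_nonneg (sub_nonneg.2 hK1) hK0.le) hε'0.le
      have c2 : 0 < Kr ^ 2 * ε' := by positivity
      nlinarith only [c0, c2, h40]
    -- the extension point, through the synthetic core in `(M, d_g)`
    haveI : Nonempty (Fin (k + 1)) := ⟨⟨0, Nat.succ_pos k⟩⟩
    have hpaths := good_paths_of_good_geodesics g hg hc x (fun y₁ y₂ ↦ hgood x y₁ y₂)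
    obtain ⟨z, hz⟩ : ∃ z : M, ∑ i, Real.cos (g.edist hg (x i) z).toReal ^ 2 ≤ γ := by
      letI := g.metricSpace hg
      have hdiam' : ∀ y z : M, dist y z ≤ Real.pi := hdiam
      exact ColdingSynthetic.exists_sum_cos_dist_sq_le hdiam' x hγ0 hγ₁0 hγ₁1
        hε'0.le hε'0.le hε'0.le hε'0.le hr2 hηr hε₂ hεK hz₀ (fun i i' hii' ↦ hx i i' hii')
        (fun i ↦ hanti (x i)) hpaths
    have hzb : ∀ i, |Real.cos (g.edist hg (x i) z).toReal| ≤ α₁ := by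
      intro i
      have h1 : Real.cos (g.edist hg (x i) z).toReal ^ 2 ≤ γ :=
        (Finset.single_le_sum (fun i' _ ↦ sq_nonneg (Real.cos (g.edist hg (x i') z).toReal))
          (Finset.mem_univ i)).trans hz
      have h2 : γ = α₁ ^ 2 := rfl
      rw [h2] at h1
      exact abs_le_of_sq_le_sq' h1 hα₁0.le |>.elim (fun h3 h4 ↦ abs_le.2 ⟨h3, h4⟩)
    refine ⟨Fin.snoc x z, fun i j hij ↦ ?_⟩
    rcases Fin.eq_castSucc_or_eq_last i with ⟨i, rfl⟩ | rfl <;>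
      rcases Fin.eq_castSucc_or_eq_last j with ⟨j, rfl⟩ | rfl
    · simp only [Fin.snoc_castSucc]
      have hij' : i ≠ j := fun h0 ↦ hij (by rw [h0])
      exact (hx i j hij').trans (by linarith only [hε'α, hα₁α, hα₁0])
    · simp only [Fin.snoc_castSucc, Fin.snoc_last]
      exact (hzb i).trans hα₁α
    · simp only [Fin.snoc_castSucc, Fin.snoc_last]
      rw [PseudoRiemannianMetric.edist_comm hg]
      exact (hzb j).trans hα₁α
    · exact absurd rfl hij

end FactVocabulary

end Literature.Geometry.Riemannian

end
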